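import Summits.CriticalPhenomena.PercolationContinuityZ3.Theorems.PercNearOneGluingNoHeavyLowerTailSahiSunflowerSun5AllOrders
import Summits.CriticalPhenomena.PercolationContinuityZ3.Theorems.PercNearOneGluingNoHeavyLowerTailSahiSunflowerSun4AllOrders
import Summits.CriticalPhenomena.PercolationContinuityZ3.Theorems.PercNearOneGluingNoHeavyLowerTailSahiSunflowerPattern
import Summits.CriticalPhenomena.PercolationContinuityZ3.Theorems.SahiConjecture
import HarnessLib

/-!
# `NoHeavyLowerTail` (crux stmt-CriticalPhenomena-4575), master-family line P2: the sunflower tower in percolation — on every finite weighted graph the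
# 4- and 5-point "all-but-one-joined" algebras satisfy Sahi's conjecture of EVERY order iff the single row `4PT-LB` / `5PT-LB` holds

Support file (seat `prim-masterthm-p2`, gen 3; `--supports stmt-CriticalPhenomena-4575`); one `@[conjecture]` definition (`FivePointLBRow`, an instance of
Sahi's `C_5` for product measures, OPEN), no sorry.  Memo SAHI-ROUTE.md §4.10–4.12.  Combines the pattern map `Sun.pat` (`…SahiSunflowerPattern`:
antitone, `row_pat_eq`, Harris ⇒ order 2) with the hierarchy theorems `Sun.sahiPositive_iff_row4` / `Sun.sahiPositive_iff_row5` (`…Sun4AllOrders`,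
`…Sun5AllOrders`: on `Sun 4`, `Sun 5` all orders ⟺ the top row, via the kernel-replayed domination identities).
* `sahiPositive_pat_iff_row4/5` — for terminals `t : Fin 4 → V` / `Fin 5 → V`: (∀ n, SahiPositive (pattern weight) n) ↔ `0 ≤ E_m(1_{(allBut t i)ᶜ} : i)` under
  the percolation weight (`m = 4`: the row `4PT-LB` in the `allBut` presentation; `m = 5`: `5PT-LB`);
* `FivePointLBRow` (OPEN; census ttrl cp-e4: 0 negative / 0 zero on all connected supports `n ≤ 7`, 3.6e6 exact evaluations) with
  `fivePointLBRow_of_sahiConjecture : SahiConjecture 5 → FivePointLBRow` and `fivePointLBRow_iff_allOrders`.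
-/

namespace Summit.CriticalPhenomena.PercolationContinuityZ3.Theorems.SahiDeltaSystem

open Finset Function MeasureTheory Literature.Combinatorics.Sahi2008
open Literature.Probability.Percolation
open Literature.Probability.Percolation.DecisionTree (ind ind_nonneg)

namespace Sun

variable {V : Type*} [Fintype V]

/-- **Four points: all orders ⟺ `4PT-LB`** (in the `allBut` presentation of the row). [this work] -/
theorem sahiPositive_pat_iff_row4 (w : Sym2 V → unitInterval) (t : Fin 4 → V) :
    (∀ n, SahiPositive (pushWeight (bernoulliWeight w) (pat t)) n) ↔ 0 ≤ sahiE (bernoulliWeight w) 4 (fun i => ind (allBut t i)ᶜ) := by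
  rw [sahiPositive_iff_row4 (pushWeight_pat_nonneg w t) (sum_pushWeight_pat w t), row_pat_eq (by norm_num) w t]

/-- **Five points: all orders ⟺ `5PT-LB`.**  For every finite weighted graph and `t : Fin 5 → V`: Sahi positivity of EVERY order on the five-point
all-but-one-joined pattern algebra ⟺ `0 ≤ E₅(1_{(allBut t i)ᶜ} : i < 5)` under the percolation weight. [this work] -/
theorem sahiPositive_pat_iff_row5 (w : Sym2 V → unitInterval) (t : Fin 5 → V) :
    (∀ n, SahiPositive (pushWeight (bernoulliWeight w) (pat t)) n) ↔ 0 ≤ sahiE (bernoulliWeight w) 5 (fun i => ind (allBut t i)ᶜ) := by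
  rw [sahiPositive_iff_row5 (pushWeight_pat_nonneg w t) (sum_pushWeight_pat w t), row_pat_eq (by norm_num) w t]

end Sun

/-- **5PT-LB — the five-point lower bound** (the `m = 5` rung of the sunflower tower; `m = 3` is `3PT-LB = SHK3⁺`, `m = 4` is `FourPointLBRow`).  For
every finite weighted graph and terminals `t : Fin 5 → V`: `0 ≤ E₅(D_0,…,D_4)`, `D_i = {the four terminals other than t i are NOT all in one open
cluster}`; in the seven cells `t(t+1)(t+2)(t+3)·r ≥ (t+1)(t+2)(t+3)e₂(u) + (t+2)(t+3)e₃(u) + (t+3)e₄(u) + e₅(u)` (tower closed form).  Instance of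
Sahi's `C_5` for product measures (`fivePointLBRow_of_sahiConjecture`); OPEN — census ttrl cp-e4 (PTLB-TOWER.md): all connected supports `n ≤ 7`,
3.6e6 exact evaluations, 0 negative, 0 zero.  [cite: Sahi2008, Conj. 5 (p. 212); LiebSahi2021, Conj. 1.1] [status: open] -/
@[conjecture] def FivePointLBRow : Prop :=
  ∀ (V : Type) [Fintype V] (w : Sym2 V → unitInterval) (t : Fin 5 → V), 0 ≤ sahiE (bernoulliWeight w) 5 (fun i => ind (allBut t i)ᶜ)

/-- **Bridge, decreasing events, any order**: Sahi positivity of order `n` of the dual product weight gives `0 ≤ E_n(1_{A_0},…,1_{A_{n−1}})` under the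
product weight for decreasing events `A_i`. [this work] -/
theorem sahiE_ind_nonneg_of_sahiPositive_lower {ι : Type*} [Fintype ι] (p : ι → unitInterval) {n : ℕ}
    (h : SahiPositive (bernoulliWeightDual p) n) {A : Fin n → Set (Set ι)} (hA : ∀ i, IsLowerSet (A i)) :
    0 ≤ sahiE (bernoulliWeight p) n (fun i => ind (A i)) := by
  have key := h (fun i x => ind (A i) (OrderDual.ofDual x)) (fun i x => ind_nonneg _ _) (fun i => monotone_ind_toDual_of_isLowerSet (hA i))
  exact key

/-- The all-but-one disconnection events are decreasing. [this work] -/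
theorem isLowerSet_compl_allBut {V : Type*} {m : ℕ} (t : Fin m → V) (i : Fin m) : IsLowerSet (allBut t i : Set (BondConfig V))ᶜ :=
  (isUpperSet_allBut t i).compl

/-- **Sahi's `C_5` ⇒ `5PT-LB`.** [this work] -/
theorem fivePointLBRow_of_sahiConjecture (hC : SahiConjecture 5) : FivePointLBRow := by
  intro V _ w t
  exact sahiE_ind_nonneg_of_sahiPositive_lower w (hC (Set (Sym2 V))ᵒᵈ (bernoulliWeightDual w) (isFKGMeasure_bernoulliWeightDual w))
    (fun i => isLowerSet_compl_allBut t i)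

/-- **`5PT-LB` ⟺ every order on every five-point all-but-one-joined algebra**: the open row holds iff the five-point pattern weight of EVERY finite
weighted graph is Sahi-positive of EVERY order. [this work] -/
theorem fivePointLBRow_iff_allOrders :
    FivePointLBRow ↔ ∀ (V : Type) [Fintype V] (w : Sym2 V → unitInterval) (t : Fin 5 → V) (n : ℕ),
      SahiPositive (pushWeight (bernoulliWeight w) (Sun.pat t)) n :=
  ⟨fun h V _ w t n => (Sun.sahiPositive_pat_iff_row5 w t).2 (h V w t) n, fun h V _ w t => (Sun.sahiPositive_pat_iff_row5 w t).1 (h V w t)⟩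

end Summit.CriticalPhenomena.PercolationContinuityZ3.Theorems.SahiDeltaSystem
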